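import Summits.Ventures.GridStability.Models.ClassicalSwingLosslessDichotomy
import HarnessLib

/-!
# GridStability/Models/ClassicalSwingLosslessEnergy — companion of `ClassicalSwingLosslessDichotomy`:
# lit-6's printed energy `V` on the reading `ClassicalSwing.toLossless` IS model-1's classical energy
# function `energy δˢ` up to the constant `U(δˢ)`; dissipation `dV/dt = −Σ D_iω_i²` along every lossless
# motion; ★ #93's WORK form and weighted M0 form by name; the uniform-λ readings (`ω_s = a′/λ`), with the
# NE39L object of record `λ = 1/10` (`ω_s = 10a′`)

Venture GRIDFUSION (LADDER-GRIDFUSION G3 model row → G2), cell `run/shared/lean/pub/gridfusion/`, seat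
gridfusion-model-1 (g7); lead g7 RULING 9b («CS-LOSSLESS-DICHOTOMY», energy identities split off under the
400-line lint). Part 1 = `Models/ClassicalSwingLosslessDichotomy.lean` (bridge `toLossless`, `syncFreq`,
`lossless_dichotomy(_of_state)`, family reading `toModelD`, WSCC9L / NE39L any-damping instances).

CONTENTS (`p : ClassicalSwing n`):
* `sum_erase_eq_two_mul_sum_lt` (bookkeeping), `toLossless_potential`, `toLossless_energy` — for
  reciprocal `B` and ANY reference configuration `δˢ`: `V(δ, ω) = energy δˢ (δ, ω) + U(δˢ)` (the typed
  classical energy function of `Models/ClassicalSwing.lean`, Sauer–Pai §9, IS lit-6's Vu–Turitsyn energy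
  up to a constant);
* `hasDerivWithinAt_energy` — DISSIPATION of the typed classical energy function along every lossless
  motion, `d/dt energy δˢ (c t) = −Σ_i D_i ω_i(t)²` (lit-6's `fderiv_energy_field` through the bridge);
  `energy_antitone` (non-increasing for `D_i ≥ 0`); `toLossless_isEquilibrium_iff`;
  `isSolutionOn_of_toLossless` (converse transport);
* ★ #93 by name, two more forms for lossless `p`, `M_i, D_i > 0`, `B` reciprocal: `lossless_dichotomy_work`
  (§5: EITHER `energy δˢ → −∞` with `Σ P′_iδ_i → +∞` OR finite energy limit, every `ω_i → 0`, every
  `P_i − P_ei(δ) → 0`) and `lossless_dichotomy_weighted` (§8 verbatim: `Σ_i|P′_i − D_iω_s|·|δ_i − δ_k| → ∞`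
  for every reference machine `k`, OR the synchronised branch);
* uniform damping: `RecastData.toModelRel_eq_toModelD` (`toModelRel λ a′ = toModelD (λM) a′`, `rfl`),
  `syncFreq_toModelRel` (`ω_s = a′/λ`), `dichotomy_toModelRel`; instances `WSCC9.postB_relL_dichotomy_uniform`,
  `NE39L.data_dichotomy_uniform`, and the OBJECT OF RECORD `NE39L.data_dichotomy_h12` (`λ = 1/10`: every
  motion of `NE39L.data.toModelRel (1/10) a′` either splits or has all ten speeds `→ 10a′` and all ten
  mismatches `P_i − M_ia′ − P_ei(δ(t)) → 0`).

THREE COLUMNS (never merged). CERTIFIED (kernel, standard axioms): identities and limit statements about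
MODEL `M_cl`-lossless (model-1's `ClassicalSwing n` with `IsLossless`; MV-2/MV-2L) and the SYNTHETIC lossless
variants WSCC9L / NE39L (MV-RD, MV-h12, MV-E6) — NOT the printed WSCC 9-bus / New England systems.
VALIDATED: nothing. MODELLED: as part 1; for `m = 0` the work form's alternative (a) CONTAINS the coherent
drift at `ω_s` whenever `Σ P′ ≠ 0` (★ #93's sentence of record), the splitting form of part 1 is the
frame-correct one; which alternative holds is NOT claimed; never a region, never «the grid synchronises».
No definition, no named fact, no `sorry`, no kit.
-/

noncomputable section

open Real Set Filter Finset
open scoped Topology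
open Literature.MathematicalPhysics.PowerSystems.ClassicalModel

namespace Summit.Ventures.GridStability.Models

namespace ClassicalSwing

variable {n : ℕ} (p : ClassicalSwing n)

/-! ### Equilibria agree; converse transport -/

/-- Equilibrium angle vectors agree (lossless `M_cl`): lit-6's power balance `P′_i = flow_i(θ)` iff
model-1's pre-transient condition `P_ei(θ) = P_i`. [cite: SauerPai1998, §7.9.3 eq. (7.212); VuTuritsyn2016, §II eq. (2)] -/
theorem toLossless_isEquilibrium_iff (hl : p.IsLossless) (θ : Fin n → ℝ) :
    p.toLossless.IsEquilibrium θ ↔ p.IsEquilibrium θ := by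
  simp only [LosslessSystem.IsEquilibrium, IsEquilibrium, p.toLossless_flow hl, toLossless_P]
  exact ⟨fun h i => by linarith [h i], fun h i => by linarith [h i]⟩

/-- Conversely, a solution of lit-6's field is a solution of `M_cl` (lossless).
[cite: SauerPai1998, §7.9.3 eqs. (7.215)–(7.216)] -/
theorem isSolutionOn_of_toLossless (hl : p.IsLossless) {c : ℝ → State n} {s : Set ℝ}
    (hc : ∀ t ∈ s, HasDerivWithinAt c (p.toLossless.field (c t)) s t) : p.IsSolutionOn c s := by
  intro t ht
  rw [← p.toLossless_field hl]
  exact hc t ht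

/-! ### The classical energy function: lit-6's `V` = model-1's `energy δˢ` + constant; dissipation -/

/-- Bookkeeping: an off-diagonal double sum of a SYMMETRIC summand is twice the sum over the lines
`i < j`. [folklore] -/
theorem sum_erase_eq_two_mul_sum_lt (f : Fin n → Fin n → ℝ) (hf : ∀ i j, f i j = f j i) :
    ∑ i, ∑ j ∈ univ.erase i, f i j = 2 * ∑ i, ∑ j ∈ univ.filter (fun j => i < j), f i j := by
  classical
  have hsplit : ∀ i, ∑ j ∈ univ.erase i, f i j =
      ∑ j ∈ univ.filter (fun j => i < j), f i j + ∑ j ∈ univ.filter (fun j => j < i), f i j := by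
    intro i
    rw [← Finset.sum_union]
    · refine Finset.sum_congr ?_ fun _ _ => rfl
      ext j
      simp only [Finset.mem_erase, Finset.mem_univ, and_true, Finset.mem_union, Finset.mem_filter, true_and]
      rcases lt_trichotomy i j with h | h | h
      · exact ⟨fun _ => Or.inl h, fun _ => ne_of_gt h⟩
      · subst h; simp
      · exact ⟨fun _ => Or.inr h, fun _ => ne_of_lt h⟩
    · rw [Finset.disjoint_filter]
      intro j _ h1 h2
      exact lt_asymm h1 h2
  have hswap : ∑ i, ∑ j ∈ univ.filter (fun j => j < i), f i j =
      ∑ i, ∑ j ∈ univ.filter (fun j => i < j), f i j := by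
    rw [Finset.sum_comm' (t' := univ) (s' := fun j => univ.filter (fun i => j < i))]
    · exact Finset.sum_congr rfl fun j _ => Finset.sum_congr rfl fun i _ => hf i j
    · intro i j
      simp
  rw [Finset.sum_congr rfl fun i _ => hsplit i, Finset.sum_add_distrib, hswap]
  ring

/-- lit-6's potential on the reading: `U(θ) = −Σ_i P′_iθ_i − Σ_{i<j} C_ij cos(θ_i − θ_j)` (reciprocal `B`).
[cite: VuTuritsyn2016, §III (energy function display); SauerPai1998, §9.6.2 eq. (9.35)] -/
theorem toLossless_potential (hB : ∀ i j, p.B i j = p.B j i) (θ : Fin n → ℝ) :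
    p.toLossless.potential θ = -∑ i, (p.P i - p.E i ^ 2 * p.G i i) * θ i -
      ∑ i, ∑ j ∈ univ.filter (fun j => i < j), p.Ccoef i j * cos (θ i - θ j) := by
  classical
  have hoff : ∑ i, ∑ j, p.toLossless.C i j * cos (θ i - θ j) =
      ∑ i, ∑ j ∈ univ.erase i, p.Ccoef i j * cos (θ i - θ j) := by
    refine Finset.sum_congr rfl fun i _ => ?_
    rw [← Finset.add_sum_erase univ _ (mem_univ i), toLossless_C, if_pos rfl, zero_mul, zero_add]
    exact Finset.sum_congr rfl fun j hj => by rw [toLossless_C, if_neg (Finset.ne_of_mem_erase hj).symm]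
  have hsym := sum_erase_eq_two_mul_sum_lt (fun i j => p.Ccoef i j * cos (θ i - θ j)) fun i j => by
    show p.Ccoef i j * cos (θ i - θ j) = p.Ccoef j i * cos (θ j - θ i)
    rw [StructurePreserving.Params.Ccoef_symm p hB i j, ← Real.cos_neg (θ j - θ i), neg_sub]
  simp only [LosslessSystem.potential, toLossless_P, Finset.univ_eq_empty, Finset.sum_empty,
    Finset.sum_const_zero, sub_zero]
  rw [hoff, hsym]
  ring

/-- **lit-6's printed energy = model-1's classical energy function + the constant `U(δˢ)`** (reciprocal
`B`, any reference configuration `δˢ`): `V(δ, ω) = energy δˢ (δ, ω) + U(δˢ)`.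
[cite: SauerPai1998, §9.6.2 eq. (9.35); VuTuritsyn2016, §III (energy function display)] -/
theorem toLossless_energy (hB : ∀ i j, p.B i j = p.B j i) (δs : Fin n → ℝ) (x : State n) :
    p.toLossless.energy x = p.energy δs x + p.toLossless.potential δs := by
  rw [LosslessSystem.energy_eq_kinetic_add_potential, p.toLossless_potential hB, p.toLossless_potential hB]
  simp only [LosslessSystem.kinetic, toLossless_M, energy, mul_sub, Finset.sum_sub_distrib]
  have hk : ∑ i, p.M i / 2 * x.2 i ^ 2 = (∑ i, p.M i * x.2 i ^ 2) / 2 := by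
    rw [Finset.sum_div]
    exact Finset.sum_congr rfl fun i _ => by ring
  rw [hk]
  ring

/-- **Dissipation of the classical energy function along every lossless motion**: for lossless `M_cl`
with reciprocal `B` and `M_i ≠ 0`, along every solution `c` on a time set `s`,
`d/dt energy δˢ (c t) = −Σ_i D_i ω_i(t)²` (within `s`). [cite: SauerPai1998, §9.6.3 eq. (9.59); Pai1981, §4.7.1; VuTuritsyn2016, §III] -/
theorem hasDerivWithinAt_energy (hl : p.IsLossless) (hB : ∀ i j, p.B i j = p.B j i)
    (hM : ∀ i, p.M i ≠ 0) (δs : Fin n → ℝ) {c : ℝ → State n} {s : Set ℝ} (hc : p.IsSolutionOn c s)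
    {t : ℝ} (ht : t ∈ s) :
    HasDerivWithinAt (fun τ => p.energy δs (c τ)) (-(∑ i, p.D i * ((c t).2 i) ^ 2)) s t := by
  have hE := ((p.toLossless.differentiable_energy (c t)).hasFDerivAt.comp_hasDerivWithinAt t
    ((IsSolutionOn.toLossless p hl hc) t ht))
  rw [p.toLossless.fderiv_energy_field (p.toLossless_C_symm hB) hM] at hE
  have heq : (fun τ => p.energy δs (c τ)) =
      fun τ => (p.toLossless.energy ∘ c) τ + (-p.toLossless.potential δs) := by
    funext τ
    simp only [Function.comp_apply, p.toLossless_energy hB δs]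
    ring
  rw [heq]
  simpa using hE.add_const (-p.toLossless.potential δs)

/-- **The classical energy function does not increase along lossless motions** (`D_i ≥ 0`, `M_i ≠ 0`,
reciprocal `B`): `0 ≤ a ≤ b ⇒ energy δˢ (c b) ≤ energy δˢ (c a)` for every global solution `c`.
[cite: SauerPai1998, §9.6.3 eq. (9.59); Chiang1995, §2 energy-function condition (i)] -/
theorem energy_antitone (hl : p.IsLossless) (hB : ∀ i j, p.B i j = p.B j i) (hM : ∀ i, p.M i ≠ 0)
    (hD : ∀ i, 0 ≤ p.D i) (δs : Fin n → ℝ) {c : ℝ → State n} (hc : p.IsSolutionOn c univ)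
    {a b : ℝ} (ha : 0 ≤ a) (hab : a ≤ b) : p.energy δs (c b) ≤ p.energy δs (c a) := by
  have h := p.toLossless.energy_le_of_le (p.toLossless_C_symm hB) hM hD
    (IsSolutionOn.toLossless_Icc p hl hc) ha hab
  rw [p.toLossless_energy hB δs, p.toLossless_energy hB δs] at h
  linarith

/-! ### ★ #93's work form and weighted M0 form on model-1's class -/

/-- **Weighted form of the splitting alternative (★ #93 §8 verbatim).** Same hypotheses: EITHER for EVERY
reference machine `k`, `Σ_i |P′_i − D_iω_s|·|δ_i(t) − δ_k(t)| → +∞`, OR the synchronised branch.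
[cite: Chiang1995, §3 Thm 3.1; DorflerBullo2012, arXiv:0910.5673 §5.1 Thm 5.1] -/
theorem lossless_dichotomy_weighted (hl : p.IsLossless) (hB : ∀ i j, p.B i j = p.B j i)
    (hM : ∀ i, 0 < p.M i) (hD : ∀ i, 0 < p.D i) {c : ℝ → State n} (hc : p.IsSolutionOn c univ) :
    (∀ k, Tendsto (fun t => ∑ i, |p.P i - p.E i ^ 2 * p.G i i - p.D i * p.syncFreq| *
        |(c t).1 i - (c t).1 k|) atTop atTop) ∨
      ((∀ i, Tendsto (fun t => (c t).2 i) atTop (𝓝 p.syncFreq)) ∧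
        ∀ i, Tendsto (fun t => p.P i - p.D i * p.syncFreq - p.Pe (c t).1 i) atTop (𝓝 0)) := by
  rcases p.toLossless.tendsto_sum_abs_sub_atTop_or_quasistatic_syncFrame (p.toLossless_C_symm hB) hM hD
      (IsSolutionOn.toLossless_Icc p hl hc) with ha | ⟨hω, hmis⟩
  · exact Or.inl ha
  · refine Or.inr ⟨hω, fun i => ?_⟩
    refine (hmis i).congr fun t => ?_
    rw [p.toLossless_flow hl, toLossless_syncFreq, toLossless_P, toLossless_D]
    ring

/-- **Work / energy form (★ #93 §5 by name).** Same hypotheses, any reference configuration `δˢ`: along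
every global solution EITHER model-1's classical energy `energy δˢ (c t) → −∞` with the injections' work
`Σ_i P′_iδ_i(t) → +∞` (for `m = 0` this alternative CONTAINS the coherent drift at `ω_s` when `Σ P′ ≠ 0`),
OR the energy converges, every `ω_i → 0` and every `P_i − P_ei(δ(t)) → 0`.
[cite: Chiang1995, §3 Thm 3.1; Leonov2001, Ch. 4 §4.2 Thm 4.1; VuTuritsyn2016, §III] -/
theorem lossless_dichotomy_work (hl : p.IsLossless) (hB : ∀ i j, p.B i j = p.B j i) (hM : ∀ i, 0 < p.M i)
    (hD : ∀ i, 0 < p.D i) (δs : Fin n → ℝ) {c : ℝ → State n} (hc : p.IsSolutionOn c univ) :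
    (Tendsto (fun t => p.energy δs (c t)) atTop atBot ∧
        Tendsto (fun t => ∑ i, (p.P i - p.E i ^ 2 * p.G i i) * (c t).1 i) atTop atTop) ∨
      ((∃ e : ℝ, Tendsto (fun t => p.energy δs (c t)) atTop (𝓝 e)) ∧
        (∀ i, Tendsto (fun t => (c t).2 i) atTop (𝓝 0)) ∧
        ∀ i, Tendsto (fun t => p.P i - p.Pe (c t).1 i) atTop (𝓝 0)) := by
  have hV : ∀ t, p.energy δs (c t) = p.toLossless.energy (c t) + (-p.toLossless.potential δs) := by
    intro t; rw [p.toLossless_energy hB δs]; ring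
  rcases p.toLossless.tendsto_energy_atBot_or_quasistatic (p.toLossless_C_symm hB) hM hD
      (IsSolutionOn.toLossless_Icc p hl hc) with ⟨hbot, hwork⟩ | ⟨⟨e, he⟩, hω, hmis⟩
  · refine Or.inl ⟨?_, hwork⟩
    simp only [hV]
    exact tendsto_atBot_add_const_right _ _ hbot
  · refine Or.inr ⟨⟨e + -p.toLossless.potential δs, ?_⟩, hω, fun i => ?_⟩
    · simp only [hV]
      exact he.add_const _
    · refine (hmis i).congr fun t => ?_
      rw [p.toLossless_flow hl, toLossless_P]
      ring

end ClassicalSwing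

/-! ### Uniform damping `D = λM`: `ω_s = a′/λ` -/

namespace RecastData

variable {n : ℕ} (d : RecastData n)

/-- The uniform-damping reading is a member of the family: `toModelRel λ a′ = toModelD (λM) a′`. [folklore] -/
theorem toModelRel_eq_toModelD (lam : ℚ) (a : ℝ) :
    d.toModelRel lam a = d.toModelD (fun i => (lam : ℝ) * d.M i) a := rfl

/-- Uniform damping `D = λM` (`λ ≠ 0`, `Σ M ≠ 0`): `ω_s = a′/λ`.
[cite: SauerPai1998, §6.10 eqs. (6.242)–(6.244); DorflerBullo2012, arXiv:0910.5673 §5.1 Thm 5.1] -/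
theorem syncFreq_toModelRel (hG : ∀ i j, i ≠ j → d.G i j = 0) (hB : ∀ i j, d.B i j = d.B j i)
    (hM : ∀ i, 0 < d.M i) {lam : ℚ} (hlam : lam ≠ 0) (a : ℝ) :
    (d.toModelRel lam a).syncFreq = a / lam := by
  rw [d.toModelRel_eq_toModelD, d.syncFreq_toModelD hG hB, ← Finset.mul_sum]
  have hS : (0 : ℝ) < ∑ i, (d.M i : ℝ) :=
    Finset.sum_pos (fun i _ => by exact_mod_cast hM i) Finset.univ_nonempty
  have hl : (lam : ℝ) ≠ 0 := by exact_mod_cast hlam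
  field_simp

/-- **Uniform damping `D = λM`, `λ > 0`**: the dichotomy with `ω_s = a′/λ` (the reading of the cell's
uniform-λ rows `toModelRel λ a′`). [cite: Chiang1995, §3 Thm 3.1; SauerPai1998, §6.10 eqs. (6.242)–(6.244)] -/
theorem dichotomy_toModelRel (hG : ∀ i j, i ≠ j → d.G i j = 0) (hB : ∀ i j, d.B i j = d.B j i)
    (hM : ∀ i, 0 < d.M i) {lam : ℚ} (hlam : 0 < lam) (a : ℝ) (x₀ : ClassicalSwing.State (n + 1)) :
    (∃! c : ℝ → ClassicalSwing.State (n + 1), c 0 = x₀ ∧ (d.toModelRel lam a).IsSolutionOn c univ) ∧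
      ∀ c : ℝ → ClassicalSwing.State (n + 1), c 0 = x₀ → (d.toModelRel lam a).IsSolutionOn c univ →
        ((∀ B : ℝ, ∃ t, 0 ≤ t ∧ ∃ i j, B < |(c t).1 i - (c t).1 j|) ∨
          ((∀ i, Tendsto (fun t => (c t).2 i) atTop (𝓝 (a / lam))) ∧
            ∀ i, Tendsto (fun t => (d.toModelRel lam a).P i - (lam : ℝ) * d.M i * (a / lam) -
              (d.toModelRel lam a).Pe (c t).1 i) atTop (𝓝 0))) := by
  have hM' : ∀ i, 0 < (d.toModelRel lam a).M i := fun i => by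
    show (0 : ℝ) < (d.M i : ℝ); exact_mod_cast hM i
  have hD' : ∀ i, 0 < (d.toModelRel lam a).D i := fun i =>
    mul_pos (by exact_mod_cast hlam) (by exact_mod_cast hM i)
  have hl : ∀ i j, i ≠ j → (d.toModelRel lam a).G i j = 0 := fun i j hij => by
    show ((d.G i j : ℚ) : ℝ) = 0
    rw [hG i j hij, Rat.cast_zero]
  have hBs : ∀ i j, (d.toModelRel lam a).B i j = (d.toModelRel lam a).B j i := fun i j => by
    show ((d.B i j : ℚ) : ℝ) = ((d.B j i : ℚ) : ℝ)
    rw [hB i j]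
  have h := (d.toModelRel lam a).lossless_dichotomy_of_state hl hBs hM' hD' x₀
  rw [d.syncFreq_toModelRel hG hB hM hlam.ne' a] at h
  exact h

end RecastData

namespace WSCC9

/-- **WSCC9L, uniform damping `λ > 0`** (the reading `postB_relL.toModelRel λ a′` of rows #18/P1): the
dichotomy with `ω_s = a′/λ`. [cite: Chiang1995, §3 Thm 3.1; SauerPai1998, §6.10 eqs. (6.242)–(6.244)] -/
theorem postB_relL_dichotomy_uniform {lam : ℚ} (hlam : 0 < lam) (a : ℝ) (x₀ : ClassicalSwing.State 3) :
    (∃! c : ℝ → ClassicalSwing.State 3, c 0 = x₀ ∧ (postB_relL.toModelRel lam a).IsSolutionOn c univ) ∧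
      ∀ c : ℝ → ClassicalSwing.State 3, c 0 = x₀ → (postB_relL.toModelRel lam a).IsSolutionOn c univ →
        ((∀ B : ℝ, ∃ t, 0 ≤ t ∧ ∃ i j, B < |(c t).1 i - (c t).1 j|) ∨
          ((∀ i, Tendsto (fun t => (c t).2 i) atTop (𝓝 (a / lam))) ∧
            ∀ i, Tendsto (fun t => (postB_relL.toModelRel lam a).P i - (lam : ℝ) * postB_relL.M i * (a / lam) -
              (postB_relL.toModelRel lam a).Pe (c t).1 i) atTop (𝓝 0))) :=
  have hM : ∀ i : Fin 3, 0 < postB_relL.M i := by decide +kernel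
  postB_relL.dichotomy_toModelRel postB_relL_transferConductance_eq_zero postB_relL_B_symm hM hlam a x₀

end WSCC9

namespace NE39L

/-- **NE39L, uniform damping `λ > 0`** (the reading `NE39L.data.toModelRel λ a′` of rows #23/P2): the
dichotomy with `ω_s = a′/λ`. [cite: Chiang1995, §3 Thm 3.1; SauerPai1998, §6.10 eqs. (6.242)–(6.244)] -/
theorem data_dichotomy_uniform {lam : ℚ} (hlam : 0 < lam) (a : ℝ) (x₀ : ClassicalSwing.State 10) :
    (∃! c : ℝ → ClassicalSwing.State 10, c 0 = x₀ ∧ (data.toModelRel lam a).IsSolutionOn c univ) ∧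
      ∀ c : ℝ → ClassicalSwing.State 10, c 0 = x₀ → (data.toModelRel lam a).IsSolutionOn c univ →
        ((∀ B : ℝ, ∃ t, 0 ≤ t ∧ ∃ i j, B < |(c t).1 i - (c t).1 j|) ∨
          ((∀ i, Tendsto (fun t => (c t).2 i) atTop (𝓝 (a / lam))) ∧
            ∀ i, Tendsto (fun t => (data.toModelRel lam a).P i - (lam : ℝ) * data.M i * (a / lam) -
              (data.toModelRel lam a).Pe (c t).1 i) atTop (𝓝 0))) :=
  have hM : ∀ i : Fin 10, 0 < data.M i := by decide +kernel
  data.dichotomy_toModelRel data_transferConductance_eq_zero data_B_symm hM hlam a x₀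

/-- **NE39L OBJECT OF RECORD, `λ = 1/10`** (LFF P2 / #23 / A24′ reading `NE39L.data.toModelRel (1/10) a′`):
from every machine state exactly one global motion, and along it EITHER some rotor-angle difference is
unbounded on `t ≥ 0` OR all ten speed deviations tend to `10·a′` and all ten mismatches
`P_i − M_ia′ − P_ei(δ(t)) → 0`. [cite: Chiang1995, §3 Thm 3.1; Leonov2001, Ch. 4 §4.2 Thm 4.1] -/
theorem data_dichotomy_h12 (a : ℝ) (x₀ : ClassicalSwing.State 10) :
    (∃! c : ℝ → ClassicalSwing.State 10, c 0 = x₀ ∧ (data.toModelRel (1 / 10) a).IsSolutionOn c univ) ∧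
      ∀ c : ℝ → ClassicalSwing.State 10, c 0 = x₀ → (data.toModelRel (1 / 10) a).IsSolutionOn c univ →
        ((∀ B : ℝ, ∃ t, 0 ≤ t ∧ ∃ i j, B < |(c t).1 i - (c t).1 j|) ∨
          ((∀ i, Tendsto (fun t => (c t).2 i) atTop (𝓝 (10 * a))) ∧
            ∀ i, Tendsto (fun t => (data.toModelRel (1 / 10) a).P i - (data.M i : ℝ) * a -
              (data.toModelRel (1 / 10) a).Pe (c t).1 i) atTop (𝓝 0))) := by
  obtain ⟨hU, hQ⟩ := data_dichotomy_uniform (lam := 1 / 10) (by norm_num) a x₀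
  refine ⟨hU, fun c h0 hc => ?_⟩
  have h10 : (a / ((1 / 10 : ℚ) : ℝ)) = 10 * a := by push_cast; ring
  rcases hQ c h0 hc with ha | ⟨hω, hmis⟩
  · exact Or.inl ha
  · refine Or.inr ⟨fun i => h10 ▸ hω i, fun i => ?_⟩
    refine (hmis i).congr fun t => ?_
    push_cast
    ring

end NE39L

end Summit.Ventures.GridStability.Models
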